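import Literature.NumberTheory.EllipticCurves.Fisher2014.KleinQuarticTwistSevenCongruence
import HarnessLib

/-!
# Fisher 2014, §4.4: the family of elliptic curves `7`-congruent to a given one, in the Halberstadt–Kraus coordinates of
# `X_E(7)` (Theorem 1.1) with the cubic forms `d₁₁, d₁₂, d₂₂` — "formulae that cover all cases"

NAMED FACT (one, published, with proof in print) + definitions + two proved lemmas, in topic `NumberTheory/EllipticCurves`,
namespace `Literature.NumberTheory.EllipticCurves.Fisher2014`.  Companion of `KleinQuarticTwistSevenCongruence.lean` (Theorem 4.8:
the family `Y_E(7)` in Theorem 3.9's coordinates `𝓕` with the single cubic form `d₁`), which leaves the points of `X_E(7)` on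
`{d₁ = 0}` uncovered (its `-- TODO(general form): … the cubic forms d_ij of §4.4`).  §4.4 of the source supplies, in the
coordinates of Theorem 1.1 (Halberstadt–Kraus), a `4 × 4` symmetric matrix of cubic forms `(d_ij)` whose diagonal entries each
give the family and do not vanish simultaneously.  This file types the entry `d₂₂` (the one needed at the points `(1 : ∓3√c₄ : 0)`,
where `d₁₁ = d₁₂ = d₁₃ = d₁₄ = 0`), together with the printed `d₁₁`, `d₁₂` and the PROVED congruence `d₁₁d₂₂ ≡ d₁₂² (mod F)`
that determines `d₂₂`.  Written for the companion/visibility records at `p = 7` of the cells `bsd-addord` / `b2b-bsdres`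
(`Summits/BirchSwinnertonDyer/…/X7SevenCongruenceCertificates.lean`), whose HONEST FRAMING applies: per-pair kernel records of
the Birch–Swinnerton-Dyer `p`-part; nothing here proves BSD; the fact is a HYPOTHESIS of its consumers.

## The source (T. Fisher, *On families of 7- and 11-congruent elliptic curves*, LMS J. Comput. Math. 17 (2014) 536–564,
## doi:10.1112/S1461157014000059; held copy `paper:doi-10-1112-s1461157014000059`), verbatim

**Theorem 1.1** (Halberstadt, Kraus, Poonen, Schaefer, Stoll; p. 538). "Let `E` be an elliptic curve with Weierstrass equation
`y² = x³ + ax + b`. Then `X_E(7) ⊂ ℙ²` has equation `F = 0` where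
`F = ax⁴ + 7bx³z + 3x²y² − 3a²x²z² − 6bxyz² − 5abxz³ + 2y³z + 3ay²z² + 2a²yz³ − 4b²z⁴`, …"
**Remark 3.10** (p. 547). "… writing `a = −27c₄` and `b = −54c₆` we have `𝓕(x, y, z) = ¼ F(6c₄z − ⅓y, x, −18z)`, …"
(`𝓕` = Theorem 3.9's quartic = `twistQuartic7`).
**Theorem 4.6** and display **(4.8)** (p. 555): quoted in `KleinQuarticTwistSevenCongruence.lean` — for a twist `X = {F = 0}` of
the Klein quartic and a cubic form `d` with `{d = 0}` meeting `X` in a divisor `2D`, `D ∼ 2T`, there is a Galois module `M`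
with: for every rational point `P = (x : y : z) ∈ X(L) ∖ {d = 0}`, not a point of inflection, the elliptic curve
`Y² = X³ − 27 (c₄(F)(x,y,z)/d(x,y,z)²) X − 54 (c₆(F)(x,y,z)/d(x,y,z)³)` (4.8) has `7`-torsion isomorphic to `M`.
**§4.4, p. 557.** "Making the change of co-ordinates in Remark 3.10, we can replace `d₁` and `d₂` by cubic forms that satisfy the
conditions of Theorem 4.6 for `X_E(7) = {F = 0} ⊂ ℙ²` and `X_E⁻(7) = {G = 0} ⊂ ℙ²`, where `F` and `G` are the quartics in
Theorem 1.1. […] In the case of `X_E(7)` we obtain a cubic form `d₁₁` with `X_E(7) ∩ {d₁₁ = 0} = 2D₁` for some divisor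
`D₁ ∼ 2T`. Then `L(3H − D₁)` has basis
`d₁₁ = −2(ax² + 3bxz + 3y² + 2ayz)z`, `d₁₂ = 2(ax² + 3bxz + 3y² + 2ayz)x`,
`d₁₃ = 4(3bx² − 2axy − 2a²xz − 3byz − 2abz²)z`, `d₁₄ = 4(a²x² + 3bxy + 4abxz + ay² + 3b²z²)z`.
More generally there are cubic forms `d_ij` for `1 ⩽ i, j ⩽ 4` such that the matrix `(d_ij)` is symmetric and each `2 × 2`
minor vanishes mod `F`. The remaining `d_ij` are computed using `d₁₁d_ij ≡ d_1i d_1j (mod F)`. Then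
`X_E(7) ∩ {d_ij = 0} = D_i + D_j` where `D₁, …, D₄` are divisors all linearly equivalent to `2T`. The family of elliptic curves
parameterised by `Y_E(7)` is now given by (4.8) with `(F, d) = (F, d_ii)` for any `1 ⩽ i ⩽ 4`. […] Our formula for the elliptic
curve corresponding to `P ∈ Y_E(7)` fails when `d_ii(P) = 0`. However the zeros of `d_ii` correspond to the hyperplane section
`{t_i = 0}` on the A-curve. Therefore, for any given point `P`, we have `d_ii(P) ≠ 0` for some `i`. So unlike the treatment in
[16, Theorem 5.2], where only the cubic form `d₁₁` was given, we have found formulae that cover all cases."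

## Transcription

* The base curve.  Print's `E : y² = x³ + ax + b`; as in the companion file every statement is written for the `c₄,c₆`-model
  `Fisher2012.c4c6Model c₄ c₆ = ⟨0,0,0,−27c₄,−54c₆⟩`, i.e. with Remark 3.10's dictionary `a = −27c₄`, `b = −54c₆` SUBSTITUTED:
  `hkQuartic7 c₄ c₆`, `hkCubic7d11/d12/d22 c₄ c₆` are the `(a,b)`-forms `…ab` at `a = −27c₄`, `b = −54c₆` (one-line `def`s).
* `hkQuartic7ab a b` = Theorem 1.1's `F`, verbatim.  `hkCubic7d11ab`, `hkCubic7d12ab` = the printed `d₁₁`, `d₁₂`.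
* `hkCubic7d22ab a b = 2(4bx³ − 2ax²y − 3a²x²z − 6bxyz + 3ay²z + 2a²yz² − 5abxz² + 2y³ − 4b²z³)` is NOT displayed in print: it
  is the cubic form determined by the printed rule `d₁₁d₂₂ ≡ d₁₂² (mod F)` — PROVED here as the polynomial identity
  `d₁₁·d₂₂ − d₁₂² = −4·(ax² + 3bxz + 3y² + 2ayz)·F` (`hkCubic7d11_mul_d22_sub_d12_sq`, by `ring`); a cubic `d` with
  `d₁₁d ≡ d₁₂² (mod F)` is unique (`F` is irreducible of degree `4 > 3`), so this IS the source's `d₂₂`.  (Found by solving the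
  `16 × 16` linear system for the coefficients of `d₂₂` and of the quadratic multiplier; the solution is unique; cell record
  `HOME/bsd-addord/k1-c2/g10/klein/`, kit j288026.)
* The member (4.8) for `(F, d₂₂)` at `P = (x, y, z) ∈ ℚ³` is `hkMember7d22 c₄ c₆ x y z = ⟨0,0,0, −27·c₄(F)(P)/d₂₂(P)²,
  −54·c₆(F)(P)/d₂₂(P)³⟩`, the covariants `c₄(F)`, `c₆(F)`, `H(F)` being the companion file's `kleinC4`, `kleinC6`, `kleinH`
  (§3.2 "applied to a twisted form", §4.1) of the quartic `F = hkQuartic7 c₄ c₆` — Theorem 4.6 is stated for ANY twist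
  `X = {F = 0}` of the Klein quartic with these covariants of that `F`.
* HYPOTHESES of the fact, as printed or weaker: `j(E) ≠ 0, 1728` (`c₄ ≠ 0 ∧ c₆ ≠ 0`; §4.4 rests on Theorem 4.8, which assumes
  it); `P ∈ X_E(7)(ℚ)`: `F(P) = 0`; `P ∉ {d₂₂ = 0}`; "not a point of inflection": spelled `H(F)(P) ≠ 0` exactly as in the companion
  file (the flexes of the smooth plane quartic `X_E(7)` are its intersections with its Hessian, so this hypothesis IMPLIES the
  printed one: weaker than print, never stronger); the member is ASSUMED non-singular (`[(hkMember7d22 …).IsElliptic]`); `K = L = ℚ`.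
* CONCLUSION: an isomorphism of `Γ_ℚ`-modules `E_P[7] ≅ E[7]` (the Weil-pairing clause "directly `7`-congruent" is DROPPED —
  weaker than print, all that visibility consumers use), stated as a `Γ_ℚ`-equivariant `geomTorsion (hkMember7d22 …) 7 ≃+
  geomTorsion (c4c6Model c₄ c₆) 7`, shape-identical to `thm48_sevenCongruent_twistQuartic7`.
  `-- TODO(general form): any field K of characteristic 0 and L/K; the symplectic type; d₃₃, d₄₄ and the reverse family`
  `-- (G, Δ·d′_ii) of §4.4; the case n = 11 (§4.5).`
* PROVED here (no fact): the `d₂₂` congruence; the transport to an arbitrary model `W/ℚ` (`sevenCongruent_hkMember7d22`).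
* Sanity of the transcription (outside the kernel; cell record `HOME/bsd-addord/k1-c2/g10/klein/`, kit j288075, exact rational
  arithmetic): at the points `P = (1 : ∓3s : 0)` of `{F = 0}` (`s² = c₄`; there `d₁₁ = d₁₂ = d₁₃ = d₁₄ = 0` and
  `d₂₂(P) = −432(c₆ ± s³) ≠ 0`) the member (4.8) for `(F, d₂₂)` is `ℚ`-ISOMORPHIC (explicit scaling `u ∈ ℚˣ`) to the rank-2
  partner found by trace comparison at all good `ℓ ≤ 3000` for `341138s1 ← 341138n1` (`u = 1154251339416`),
  `223587ck1 ← 223587cc1` (`u = 63894009816`), `84966ea1 ← 84966dx1` (`u = 7955876376`; this pair is independently certified on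
  `X_E⁻(7)` by Theorem 4.8, kit j281106) and `141512r1 ← 141512m1` (`u = 198621714816`) — Cremona labels.

## References
* T. Fisher, LMS J. Comput. Math. 17 (2014) 536–564, Thm. 1.1, Rem. 3.10, §3.2, §4.1, Thm. 4.6, (4.8), §4.4 (p. 557).
  [Fisher2014SevenElevenCongruent]
* E. Halberstadt, A. Kraus, *Sur la courbe modulaire X_E(7)*, Experiment. Math. 12 (2003) 27–40, Thm. 5.2 (the form `d₁₁` only).
  [HalberstadtKraus2003XE7]
* B. Poonen, E. F. Schaefer, M. Stoll, Duke Math. J. 137 (2007), §7. [PoonenSchaeferStoll2007]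
-/

set_option autoImplicit false

noncomputable section

open scoped Classical

open MvPolynomial WeierstrassCurve
open Literature.NumberTheory.EllipticCurves.Fisher2012 (c4c6Model exists_geomTorsion_addEquiv_c4c6Model)

namespace Literature.NumberTheory.EllipticCurves.Fisher2014

/-! ### Theorem 1.1's quartic and §4.4's cubic forms, in `a, b` (verbatim) -/

/-- Theorem 1.1's quartic `F` (Halberstadt–Kraus): an equation of `X_E(7) ⊂ ℙ²` for `E : y² = x³ + ax + b`:
`F = ax⁴ + 7bx³z + 3x²y² − 3a²x²z² − 6bxyz² − 5abxz³ + 2y³z + 3ay²z² + 2a²yz³ − 4b²z⁴`; `X 0 = x`, `X 1 = y`, `X 2 = z`.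
[cite: Fisher2014SevenElevenCongruent, Thm. 1.1 (the quartic F, p. 538)] -/
def hkQuartic7ab (a b : ℚ) : MvPolynomial (Fin 3) ℚ :=
  C a * X 0 ^ 4 + 7 * C b * X 0 ^ 3 * X 2 + 3 * X 0 ^ 2 * X 1 ^ 2 - 3 * C a ^ 2 * X 0 ^ 2 * X 2 ^ 2
    - 6 * C b * X 0 * X 1 * X 2 ^ 2 - 5 * C a * C b * X 0 * X 2 ^ 3 + 2 * X 1 ^ 3 * X 2 + 3 * C a * X 1 ^ 2 * X 2 ^ 2
    + 2 * C a ^ 2 * X 1 * X 2 ^ 3 - 4 * C b ^ 2 * X 2 ^ 4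

/-- The quadric `q = ax² + 3bxz + 3y² + 2ayz` common to `d₁₁ = −2qz` and `d₁₂ = 2qx` (§4.4, p. 557).
[cite: Fisher2014SevenElevenCongruent, §4.4 (the display of d₁₁, d₁₂, p. 557)] -/
def hkQuad7ab (a b : ℚ) : MvPolynomial (Fin 3) ℚ :=
  C a * X 0 ^ 2 + 3 * C b * X 0 * X 2 + 3 * X 1 ^ 2 + 2 * C a * X 1 * X 2

/-- §4.4's cubic form `d₁₁ = −2(ax² + 3bxz + 3y² + 2ayz)z` (with `X_E(7) ∩ {d₁₁ = 0} = 2D₁`, `D₁ ∼ 2T`).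
[cite: Fisher2014SevenElevenCongruent, §4.4 (the display of d₁₁, p. 557)] -/
def hkCubic7d11ab (a b : ℚ) : MvPolynomial (Fin 3) ℚ :=
  -2 * hkQuad7ab a b * X 2

/-- §4.4's cubic form `d₁₂ = 2(ax² + 3bxz + 3y² + 2ayz)x`. [cite: Fisher2014SevenElevenCongruent, §4.4 (the display of d₁₂, p. 557)] -/
def hkCubic7d12ab (a b : ℚ) : MvPolynomial (Fin 3) ℚ :=
  2 * hkQuad7ab a b * X 0

/-- §4.4's diagonal cubic form `d₂₂`, determined by the printed rule `d₁₁d₂₂ ≡ d₁₂² (mod F)` (proved below as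
`hkCubic7d11_mul_d22_sub_d12_sq`): `d₂₂ = 2(4bx³ − 2ax²y − 3a²x²z − 6bxyz + 3ay²z + 2a²yz² − 5abxz² + 2y³ − 4b²z³)`.
[cite: Fisher2014SevenElevenCongruent, §4.4 ("The remaining d_ij are computed using d₁₁d_ij ≡ d_1i d_1j (mod F)", p. 557)] -/
def hkCubic7d22ab (a b : ℚ) : MvPolynomial (Fin 3) ℚ :=
  2 * (4 * C b * X 0 ^ 3 - 2 * C a * X 0 ^ 2 * X 1 - 3 * C a ^ 2 * X 0 ^ 2 * X 2 - 6 * C b * X 0 * X 1 * X 2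
    + 3 * C a * X 1 ^ 2 * X 2 + 2 * C a ^ 2 * X 1 * X 2 ^ 2 - 5 * C a * C b * X 0 * X 2 ^ 2 + 2 * X 1 ^ 3
    - 4 * C b ^ 2 * X 2 ^ 3)

/-- **The defining congruence of `d₂₂` holds exactly**: `d₁₁·d₂₂ − d₁₂² = −4·q·F` in `ℚ[x,y,z]` (`q = ax² + 3bxz + 3y² + 2ayz`),
so `d₁₁d₂₂ ≡ d₁₂·d₁₂ (mod F)` as printed; a polynomial identity (`ring`).
[cite: Fisher2014SevenElevenCongruent, §4.4 ("d₁₁d_ij ≡ d_1i d_1j (mod F)", p. 557)] -/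
theorem hkCubic7d11_mul_d22_sub_d12_sq (a b : ℚ) :
    hkCubic7d11ab a b * hkCubic7d22ab a b - hkCubic7d12ab a b ^ 2 = -4 * hkQuad7ab a b * hkQuartic7ab a b := by
  simp only [hkCubic7d11ab, hkCubic7d22ab, hkCubic7d12ab, hkQuad7ab, hkQuartic7ab]
  ring

/-! ### The same objects for the `c₄,c₆`-model (`a = −27c₄`, `b = −54c₆`, Remark 3.10) and the member (4.8) for `(F, d₂₂)` -/

/-- Theorem 1.1's quartic for `E = c4c6Model c₄ c₆ : y² = x³ − 27c₄x − 54c₆` (`a = −27c₄`, `b = −54c₆`, Remark 3.10).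
[cite: Fisher2014SevenElevenCongruent, Thm. 1.1 with Rem. 3.10] -/
def hkQuartic7 (c₄ c₆ : ℚ) : MvPolynomial (Fin 3) ℚ := hkQuartic7ab (-27 * c₄) (-54 * c₆)

/-- §4.4's `d₁₁` for `E = c4c6Model c₄ c₆`. [cite: Fisher2014SevenElevenCongruent, §4.4 with Rem. 3.10] -/
def hkCubic7d11 (c₄ c₆ : ℚ) : MvPolynomial (Fin 3) ℚ := hkCubic7d11ab (-27 * c₄) (-54 * c₆)

/-- §4.4's `d₁₂` for `E = c4c6Model c₄ c₆`. [cite: Fisher2014SevenElevenCongruent, §4.4 with Rem. 3.10] -/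
def hkCubic7d12 (c₄ c₆ : ℚ) : MvPolynomial (Fin 3) ℚ := hkCubic7d12ab (-27 * c₄) (-54 * c₆)

/-- §4.4's `d₂₂` for `E = c4c6Model c₄ c₆`. [cite: Fisher2014SevenElevenCongruent, §4.4 with Rem. 3.10] -/
def hkCubic7d22 (c₄ c₆ : ℚ) : MvPolynomial (Fin 3) ℚ := hkCubic7d22ab (-27 * c₄) (-54 * c₆)

/-- The member of the family (4.8) of Theorem 4.6 at `P = (x, y, z)`, for `(F, d) = (F, d₂₂)` of §4.4 (`F` = Theorem 1.1's
quartic of `E = c4c6Model c₄ c₆`): `Y² = X³ − 27 (c₄(F)(P)/d₂₂(P)²) X − 54 (c₆(F)(P)/d₂₂(P)³)`, the covariants `c₄(F)`, `c₆(F)`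
being `kleinC4`, `kleinC6` (§3.2, §4.1). [cite: Fisher2014SevenElevenCongruent, Thm. 4.6 display (4.8) with §4.4 "(F, d) = (F, d_ii)"] -/
def hkMember7d22 (c₄ c₆ x y z : ℚ) : WeierstrassCurve ℚ :=
  ⟨0, 0, 0,
    -27 * (MvPolynomial.eval ![x, y, z] (kleinC4 (hkQuartic7 c₄ c₆)) /
      MvPolynomial.eval ![x, y, z] (hkCubic7d22 c₄ c₆) ^ 2),
    -54 * (MvPolynomial.eval ![x, y, z] (kleinC6 (hkQuartic7 c₄ c₆)) /
      MvPolynomial.eval ![x, y, z] (hkCubic7d22 c₄ c₆) ^ 3)⟩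

/-! ### The named fact -/

/-- **Fisher 2014, Theorem 4.6 + §4.4, the family `Y_E(7)` in Halberstadt–Kraus coordinates with `d = d₂₂`, `K = L = ℚ`**:
let `E : y² = x³ − 27c₄x − 54c₆` be an elliptic curve over `ℚ` with `j(E) ≠ 0, 1728` (i.e. `c₄ ≠ 0`, `c₆ ≠ 0`), and let
`P = (x : y : z)` be a rational point of `X_E(7) = {F = 0}` (`F` = Theorem 1.1's quartic for `a = −27c₄`, `b = −54c₆`) with
`d₂₂(P) ≠ 0` which is not a point of inflection (`H(F)(P) ≠ 0`).  Then the member `E_P` of the family (4.8) for `(F, d₂₂)`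
(assumed non-singular) is `7`-congruent to `E`: there is an isomorphism of `Γ_ℚ`-modules `E_P[7] ≅ E[7]` (print: "The family of
elliptic curves parameterised by `Y_E(7)` is now given by (4.8) with `(F, d) = (F, d_ii)` for any `1 ⩽ i ⩽ 4`" — DIRECTLY
`7`-congruent; the Weil-pairing clause is dropped).  NAMED FACT, not proved here.
[cite: Fisher2014SevenElevenCongruent, §4.4 (p. 557) with Thm. 4.6, display (4.8), Thm. 1.1 and Rem. 3.10] -/
def sec44_sevenCongruent_hkQuartic7_d22 : Prop :=
  ∀ (c₄ c₆ x y z : ℚ) [(c4c6Model c₄ c₆).IsElliptic] [(hkMember7d22 c₄ c₆ x y z).IsElliptic],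
    c₄ ≠ 0 → c₆ ≠ 0 →
    MvPolynomial.eval ![x, y, z] (hkQuartic7 c₄ c₆) = 0 →
    MvPolynomial.eval ![x, y, z] (hkCubic7d22 c₄ c₆) ≠ 0 →
    MvPolynomial.eval ![x, y, z] (kleinH (hkQuartic7 c₄ c₆)) ≠ 0 →
    ∃ e : geomTorsion (hkMember7d22 c₄ c₆ x y z) (7 : ℤ) ≃+ geomTorsion (c4c6Model c₄ c₆) (7 : ℤ),
      ∀ (σ : Field.absoluteGaloisGroup ℚ) (T : geomTorsion (hkMember7d22 c₄ c₆ x y z) (7 : ℤ)),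
        e (σ • T) = σ • e T

/-! ### Proved: transport to an arbitrary model -/

/-- **Transport of §4.4's formula (`(F, d₂₂)`) to any model.** For every elliptic curve `W/ℚ` with `c₄(W) ≠ 0`, `c₆(W) ≠ 0`
(`j ≠ 0, 1728`) and every rational point `P = (x : y : z)` of `X_W(7) = {F = 0}` written in Halberstadt–Kraus coordinates for the
`c₄,c₆`-model of `W`, off `{d₂₂ = 0}` and off the Hessian, with non-singular member `E_P`: `E_P[7] ≅ W[7]` as `Γ_ℚ`-modules.
Conditional on the named fact `sec44_sevenCongruent_hkQuartic7_d22`; the transport along `W ≅ c4c6Model W.c₄ W.c₆` is proved.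
[cite: Fisher2014SevenElevenCongruent, §4.4 with Thm. 4.6] -/
theorem sevenCongruent_hkMember7d22 (hF : sec44_sevenCongruent_hkQuartic7_d22)
    (W : WeierstrassCurve ℚ) [W.IsElliptic] (x y z : ℚ) [(hkMember7d22 W.c₄ W.c₆ x y z).IsElliptic]
    (h0 : W.c₄ ≠ 0) (h1728 : W.c₆ ≠ 0)
    (hP : MvPolynomial.eval ![x, y, z] (hkQuartic7 W.c₄ W.c₆) = 0)
    (hd : MvPolynomial.eval ![x, y, z] (hkCubic7d22 W.c₄ W.c₆) ≠ 0)
    (hH : MvPolynomial.eval ![x, y, z] (kleinH (hkQuartic7 W.c₄ W.c₆)) ≠ 0) :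
    ∃ e : geomTorsion (hkMember7d22 W.c₄ W.c₆ x y z) (7 : ℤ) ≃+ geomTorsion W (7 : ℤ),
      ∀ (σ : Field.absoluteGaloisGroup ℚ) (T : geomTorsion (hkMember7d22 W.c₄ W.c₆ x y z) (7 : ℤ)),
        e (σ • T) = σ • e T := by
  obtain ⟨e₁, he₁⟩ := hF W.c₄ W.c₆ x y z h0 h1728 hP hd hH
  obtain ⟨e₂, he₂⟩ := exists_geomTorsion_addEquiv_c4c6Model W 7
  refine ⟨e₁.trans e₂.symm, fun σ T => ?_⟩
  simp only [AddEquiv.trans_apply]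
  apply e₂.injective
  rw [AddEquiv.apply_symm_apply, he₂, AddEquiv.apply_symm_apply, he₁]

end Literature.NumberTheory.EllipticCurves.Fisher2014

end
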